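import Summits.BirchSwinnertonDyer.BirchSwinnertonDyer.Theorems.ResidualThetaTransportAtTwoResidualSignedLambdaLowerCMAtTwoColemanPlusOntoTwo
import Summits.BirchSwinnertonDyer.BirchSwinnertonDyer.Theorems.ThetaPartnerAtTwoSignedControlAtTwoPlusCoinvOfHonda
import Literature.NumberTheory.EllipticCurves.Sprung2012.HondaLevelTwoRelationsProofs
import Mathlib.Algebra.Polynomial.Taylor
import HarnessLib

/-!
# Input (R1) of road T / road Λ to item 23110, POINT-LEVEL half (ii): RANK GROWTH of Kobayashi's plus points on the
# cyclotomic `ℤ₂`-tower of `ℚ₂` — for every `B` there are `B` points of `E⁺(ℚ_{2,2m})` linearly independent modulo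
# `2·E(ℚ_{2,∞}·ℚ_v)` — from `Col⁺` ONTO at `2` (`SignedColemanImage.hondaPlus_onto_two`) by a triangular-system argument

Routes `ResidualThetaTransportAtTwo` (RTT, crux r201 `ResidualLambdaFormulaNegDiscAtTwo`, stmt-BirchSwinnertonDyer-23110) /
`ThetaPartnerAtTwo`. Seat `prover-bsd-wall-tp2-p2x-w2` g15; `--supports stmt-BirchSwinnertonDyer-23110`. THEOREMS ONLY (no definition,
no named fact, no `sorry`); route-independent; closes nothing.

WHY (lead memo RLF-TWIST-ROAD-g12 §3 (R1) «Missing: rank growth corank (H⁺)^{Γ_n} → ∞»; companion of `…PlusDualFreeRankOne` whose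
hypothesis `S[p]` INFINITE for `S = E⁺_∞ ⊗ ℚ₂/ℤ₂` this file supplies at the level of points). The tree's Honda systems encode
GENERATION, never rank (`Sprung2012/HondaOrbitRankOfSurjectiveProofs`: «absent from the tree»); at `p = 2` rank is nevertheless a
THEOREM, because rtt-p2 g14 proved `Col⁺` onto from ONE unit functional (`exists_pairingSum_eq_omegaMinus_mul_two`): for every
`a ∈ Λ` some functional `z` on the tower `A = E(ℚ_{2,∞}·ℚ_v)` has `P_{2m,d_{2m}}(z) ≡ ω⁻_{2m}·a (mod ω_{2m})`. Reading this
COEFFICIENTWISE in the `ℤ₂`-basis `(1+T)ʲ` of `Λ/ω_n` (tree `Sprung2012.eq_zero_of_toIwasawa_cyclotomicOmega_dvd_sum`) with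
`a = (1+T)ⁱ`, `i < R`, gives functionals `zᵢ` with `zᵢ(g^{e+i′} d_{2m}) = δ_{i i′}` for `i′ ≥ i` (`e = deg ω⁻_{2m}`, `ω⁻_{2m}` MONIC in
`1+T`), a unitriangular system, whence `g^{e}d_{2m}, …, g^{e+R−1}d_{2m}` are independent mod `2A` for every `R ≤ 4^m − e`;
and `3e + 1 = 4^m`.

* §1 (abstract) `forall_dvd_of_sum_zsmul_eq_nsmul_of_triangular` — functionals `zᵢ : A → ℤ_p` with `zᵢ(xᵢ) = 1`, `zᵢ(x_{i′}) = 0`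
  (`i < i′`) force `p ∣ cᵢ` in every relation `∑ cᵢ xᵢ = p·y`, `y ∈ A`.
* §2 (any `p`, `K`) `evalOn_pow_smul_eq_coeff_of_dvd` — `ω_n ∣ P_{n,d}(z) − taylor₁ R`, `deg R < pⁿ` ⟹ `z(gʲd) = coeff_j R`;
  `toIwasawa_cyclotomicOmegaMinus_mul_pow_eq` — `ω⁻_n·(1+T)ⁱ = taylor₁ (Q̃·Xⁱ)`, `Q̃ = ∏ Φ_{p^{2k−1}}` (monic, degree `e`);
  `succ_mul_natDegree_add_one_eq_pow` — `(p+1)·e + 1 = p^{2m}`.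
* §3 (any `p`, `K`) **`forall_dvd_of_onto`** — ONTO at level `n` for `d` with orbit in `A` ⟹ `g^{e+i}d` (`i < R`, `e + R ≤ pⁿ`) independent
  mod `p·A`.
* §4 (`K = ℚ`, `p = 2`, UNCONDITIONAL for `GoodSS W 2`, `a₂ = 0`, cyclotomic `κ`, `v ∋ 2`) **`exists_indep_mod_two_signedLocalPoints`** —
  `∀ B, ∃ m` and `B` points of `E⁺(ℚ_{2,2m})` independent modulo `2·E(ℚ_{2,∞}·ℚ_v)` (a fortiori modulo `2·⋃ₙE⁺(ℚ_{2,n})`);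
  **`not_exists_finset_cover_mod_two`** — `⋃ₙ E⁺(ℚ_{2,n})` has infinitely many classes mod `2` (no finite set of representatives).

HONEST FRAMING: closes nothing; 23110 is NOT proved; BSD is not proved by any of this.
References: [Kobayashi2003] Thm. 6.2, Prop. 8.12, Prop. 8.23; [BDKim2007] Prop. 3.17 («rank of E^±(k_n)»); [Sprung2012] Def. 3.1, Prop. 7.3;
[Washington1997] §7.1 Prop. 7.2, §13.2.
-/

set_option autoImplicit false
-- the Theorems namespace of this sub repeats the summit name by design (D-0017 nested layout)
set_option linter.dupNamespace false

noncomputable section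

open scoped Classical NumberField
open Polynomial Finset

namespace Summit.BirchSwinnertonDyer.BirchSwinnertonDyer.Theorems.SignedEC.PlusRankGrowth

open Literature.NumberTheory.EllipticCurves Literature.NumberTheory.GaloisRepresentations
  WeierstrassCurve ZpExtension Literature.NumberTheory.EllipticCurves.Kobayashi2003
  Literature.NumberTheory.EllipticCurves.Sprung2012 Literature.NumberTheory.EllipticCurves.Sprung2017
  Summit.BirchSwinnertonDyer.Rank1Residual.Additive

universe u

/-! ## §1 Abstract: a unitriangular system of functionals forces independence modulo `p` -/

section Abstract

variable {p : ℕ} [Fact p.Prime] {L : Type*} [AddCommGroup L]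

/-- **Independence modulo `p` from a unitriangular system of `ℤ_p`-valued functionals.** Points `x₀, …, x_{R−1}` of a subgroup
`A ≤ L` and functionals `zᵢ : A → ℤ_p` with `zᵢ(xᵢ) = 1` and `zᵢ(x_{i′}) = 0` for `i < i′`: every relation `∑ cᵢ xᵢ = p·y` with
`y ∈ A` has all `cᵢ ≡ 0 (mod p)` (apply `zᵢ` and induct on `i`). [folklore] -/
theorem forall_dvd_of_sum_zsmul_eq_nsmul_of_triangular {A : AddSubgroup L} {R : ℕ} {x : Fin R → L} (hx : ∀ i, x i ∈ A)
    (z : Fin R → (A →+ ℤ_[p])) (hdiag : ∀ i, z i ⟨x i, hx i⟩ = 1)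
    (hupper : ∀ i i' : Fin R, i < i' → z i ⟨x i', hx i'⟩ = 0)
    (c : Fin R → ℤ) {y : L} (hy : y ∈ A) (hrel : ∑ i, c i • x i = p • y) :
    ∀ i, (p : ℤ) ∣ c i := by
  -- evaluate `z i` on the relation
  have heval : ∀ i, ∑ i', (c i' : ℤ_[p]) * z i ⟨x i', hx i'⟩ = (p : ℤ_[p]) * z i ⟨y, hy⟩ := by
    intro i
    have hmem : (∑ i', c i' • x i') ∈ A := A.sum_mem fun i' _ ↦ A.zsmul_mem (hx i') _
    have e1 : (⟨∑ i', c i' • x i', hmem⟩ : A) = ∑ i', c i' • (⟨x i', hx i'⟩ : A) :=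
      Subtype.ext (by simp)
    have e2 : (⟨∑ i', c i' • x i', hmem⟩ : A) = p • (⟨y, hy⟩ : A) := Subtype.ext (by simpa using hrel)
    have h := congrArg (z i) (e1.symm.trans e2)
    rw [map_sum, map_nsmul] at h
    simp only [map_zsmul, zsmul_eq_mul] at h
    rw [h, nsmul_eq_mul]
  -- strong induction on `i`
  suffices H : ∀ n : ℕ, ∀ i : Fin R, (i : ℕ) = n → ∃ b : ℤ_[p], (c i : ℤ_[p]) = (p : ℤ_[p]) * b by
    intro i
    obtain ⟨b, hb⟩ := H i i rfl
    have h1 : (p : ℤ_[p]) ^ 1 ∣ ((c i : ℤ) : ℤ_[p]) := by rw [pow_one, hb]; exact dvd_mul_right _ _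
    rw [PadicInt.pow_p_dvd_int_iff 1, pow_one] at h1
    exact h1
  intro n
  induction n using Nat.strong_induction_on with
  | _ n ih =>
    intro i hi
    -- coefficients below `i` are divisible by `p`
    have hlow : ∀ i' : Fin R, i' < i → ∃ b : ℤ_[p], (c i' : ℤ_[p]) = (p : ℤ_[p]) * b :=
      fun i' hi' ↦ ih i' (by rw [← hi]; exact hi') i' rfl
    -- split the sum at `i`
    have hsplit := heval i
    rw [← Finset.add_sum_erase _ _ (Finset.mem_univ i), hdiag, mul_one] at hsplit
    let f : Fin R → ℤ_[p] := fun i' ↦ if h : i' < i then Classical.choose (hlow i' h) * z i ⟨x i', hx i'⟩ else 0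
    have hf : ∀ i' ∈ (Finset.univ : Finset (Fin R)).erase i,
        (c i' : ℤ_[p]) * z i ⟨x i', hx i'⟩ = (p : ℤ_[p]) * f i' := by
      intro i' hi'
      have hne : i' ≠ i := (Finset.mem_erase.mp hi').1
      rcases lt_or_gt_of_ne hne with hlt | hgt
      · simp only [f, dif_pos hlt]
        rw [← mul_assoc, ← Classical.choose_spec (hlow i' hlt)]
      · simp only [f, dif_neg (not_lt.mpr hgt.le)]
        rw [hupper i i' hgt, mul_zero, mul_zero]
    rw [Finset.sum_congr rfl hf, ← Finset.mul_sum] at hsplit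
    exact ⟨z i ⟨y, hy⟩ - ∑ i' ∈ (Finset.univ : Finset (Fin R)).erase i, f i', by rw [mul_sub, ← hsplit, add_sub_cancel_right]⟩

end Abstract

/-! ## §2 Coefficient extraction modulo `ω_n` and the polynomial `ω⁻_n` in the `(1+T)`-basis -/

section Omega

variable {K : Type u} [Field K] {p : ℕ} [Fact p.Prime]
variable {E : Type u} [Field E] [Algebra K E] (W : WeierstrassCurve K)

/-- The coercion of `taylor 1 R` for `deg R < N`: `∑_{j<N} C(coeff_j R)·(1+T)ʲ` in `Λ`. [folklore] -/
theorem coe_taylor_one_eq_sum (R : ℤ_[p][X]) {N : ℕ} (hR : R.natDegree < N) :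
    ((taylor 1 R : ℤ_[p][X]) : PowerSeries ℤ_[p]) =
      ∑ j ∈ range N, PowerSeries.C (R.coeff j) * (1 + PowerSeries.X) ^ j := by
  conv_lhs => rw [as_sum_range' R N hR]
  rw [map_sum, ← Polynomial.coeToPowerSeries.ringHom_apply, map_sum]
  refine sum_congr rfl fun j _ => ?_
  rw [taylor_monomial, Polynomial.coeToPowerSeries.ringHom_apply, Polynomial.coe_mul, Polynomial.coe_pow,
    Polynomial.coe_C, Polynomial.coe_add, Polynomial.coe_X, Polynomial.coe_C, map_one, add_comm]

/-- **Coefficient extraction**: if `ω_n ∣ P_{n,d}(z) − taylor₁ R` in `Λ` with `deg R < pⁿ`, then `z(gʲ•d) = coeff_j R` for all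
`j < pⁿ` (`Λ/ω_n` is `ℤ_p`-free on the `(1+T)ʲ`, `j < pⁿ`: tree `Sprung2012.eq_zero_of_toIwasawa_cyclotomicOmega_dvd_sum`).
[cite: Washington1997, Prop. 7.2] [cite: Sprung2012, Def. 3.1 and Cor. 2.10 (p. 1489)] -/
theorem evalOn_pow_smul_eq_coeff_of_dvd (A : AddSubgroup (localPoints W E)) (g : Field.absoluteGaloisGroup E) (n : ℕ)
    (d : localPoints W E) (z : A →+ ℤ_[p]) (R : ℤ_[p][X]) (hR : R.natDegree < p ^ n)
    (h : toIwasawa p (cyclotomicOmega p n) ∣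
      Sprung2012.pairingSum W A g n d z - ((taylor 1 R : ℤ_[p][X]) : PowerSeries ℤ_[p])) {j : ℕ} (hj : j < p ^ n) :
    Sprung2012.evalOn W A z (g ^ j • d) = R.coeff j := by
  rw [Sprung2012.pairingSum_def, coe_taylor_one_eq_sum R hR, ← sum_sub_distrib] at h
  have e : ∑ j ∈ range (p ^ n), (PowerSeries.C (Sprung2012.evalOn W A z (g ^ j • d)) * (1 + PowerSeries.X) ^ j -
      PowerSeries.C (R.coeff j) * (1 + PowerSeries.X) ^ j) =
      ∑ j ∈ range (p ^ n), PowerSeries.C (Sprung2012.evalOn W A z (g ^ j • d) - R.coeff j) * (1 + PowerSeries.X) ^ j :=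
    sum_congr rfl fun j _ => by rw [map_sub, sub_mul]
  rw [e] at h
  exact sub_eq_zero.mp (Sprung2012.eq_zero_of_toIwasawa_cyclotomicOmega_dvd_sum _ h hj)

/-- **`ω⁻_n·(1+T)ⁱ = taylor₁ (Q̃·Xⁱ)` in `Λ`**, `Q̃ = (∏_{k ∈ [1,(n+1)/2]} Φ_{p^{2k−1}})` with coefficients in `ℤ_p`: `ω⁻_n = Q̃(1+T)`.
[cite: Pollack2003, §6.5 (display before Prop. 6.18)] -/
theorem toIwasawa_cyclotomicOmegaMinus_mul_pow_eq (n i : ℕ) :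
    toIwasawa p (cyclotomicOmegaMinus p n) * (1 + PowerSeries.X) ^ i =
      ((taylor 1 (((∏ k ∈ Icc 1 ((n + 1) / 2), cyclotomic (p ^ (2 * k - 1)) ℤ).map (Int.castRingHom ℤ_[p])) * X ^ i) :
        ℤ_[p][X]) : PowerSeries ℤ_[p]) := by
  have hcomp : cyclotomicOmegaMinus p n = (∏ k ∈ Icc 1 ((n + 1) / 2), cyclotomic (p ^ (2 * k - 1)) ℤ).comp (X + 1) := by
    rw [cyclotomicOmegaMinus, Polynomial.prod_comp]
  rw [taylor_mul, taylor_X_pow, taylor_apply, Polynomial.C_1, Polynomial.coe_mul, Polynomial.coe_pow, Polynomial.coe_add,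
    Polynomial.coe_X, Polynomial.coe_one, add_comm (PowerSeries.X : PowerSeries ℤ_[p]) 1]
  congr 1
  change (((cyclotomicOmegaMinus p n).map (Int.castRingHom ℤ_[p]) : ℤ_[p][X]) : PowerSeries ℤ_[p]) = _
  rw [hcomp, Polynomial.map_comp, Polynomial.map_add, Polynomial.map_X, Polynomial.map_one]

/-- `Q̃ = ∏_{k ∈ [1,(n+1)/2]} Φ_{p^{2k−1}}` over `ℤ_p` is monic. [folklore] -/
theorem monic_prod_cyclotomic_map (n : ℕ) :
    ((∏ k ∈ Icc 1 ((n + 1) / 2), cyclotomic (p ^ (2 * k - 1)) ℤ).map (Int.castRingHom ℤ_[p])).Monic :=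
  (monic_prod_of_monic _ _ fun _ _ => cyclotomic.monic _ ℤ).map _

/-- `deg Q̃ = ∑_{k ∈ [1,(n+1)/2]} φ(p^{2k−1})`. [folklore] -/
theorem natDegree_prod_cyclotomic_map (n : ℕ) :
    ((∏ k ∈ Icc 1 ((n + 1) / 2), cyclotomic (p ^ (2 * k - 1)) ℤ).map (Int.castRingHom ℤ_[p])).natDegree =
      ∑ k ∈ Icc 1 ((n + 1) / 2), Nat.totient (p ^ (2 * k - 1)) := by
  rw [(monic_prod_of_monic _ _ fun _ _ => cyclotomic.monic _ ℤ).natDegree_map,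
    natDegree_prod_of_monic _ _ fun _ _ => cyclotomic.monic _ ℤ]
  exact sum_congr rfl fun k _ => natDegree_cyclotomic _ ℤ

/-- **`(p+1)·deg ω⁻_{2m} + 1 = p^{2m}`**: `deg ω⁻_{2m} = ∑_{k=1}^{m} φ(p^{2k−1}) = (p^{2m} − 1)/(p + 1)`. [folklore] -/
theorem succ_mul_natDegree_add_one_eq_pow (m : ℕ) :
    (p + 1) * ((∏ k ∈ Icc 1 ((2 * m + 1) / 2), cyclotomic (p ^ (2 * k - 1)) ℤ).map (Int.castRingHom ℤ_[p])).natDegree + 1 =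
      p ^ (2 * m) := by
  have hp : p.Prime := Fact.out
  rw [natDegree_prod_cyclotomic_map, show (2 * m + 1) / 2 = m by omega]
  induction m with
  | zero => simp
  | succ m ih =>
    rw [Finset.sum_Icc_succ_top (by omega : 1 ≤ m + 1), mul_add, add_right_comm, ih,
      show 2 * (m + 1) - 1 = 2 * m + 1 by omega, Nat.totient_prime_pow_succ hp]
    have h1 : ((p - 1 : ℕ) : ℤ) = (p : ℤ) - 1 := by rw [Nat.cast_sub hp.one_le, Nat.cast_one]
    apply Nat.cast_injective (R := ℤ)
    push_cast
    rw [h1]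
    ring

end Omega

/-! ## §3 Independence modulo `p` from `Col⁺` onto, any `p`, any base -/

section Onto

variable {K : Type u} [Field K] {p : ℕ} [Fact p.Prime]
variable {E : Type u} [Field E] [Algebra K E] (W : WeierstrassCurve K)

/-- **Rank from ONTO.** Let `A ≤ E(K̄_v)` be a subgroup, `g ∈ Γ_{K_v}`, `n` a level and `d` a point whose `g`-orbit lies in `A`,
such that the pairing sums at level `n` are ONTO `ω⁻_n·Λ` modulo `ω_n`: `∀ a ∃ z, ω_n ∣ P_{n,d}(z) − ω⁻_n·a`. Let
`e = deg ω⁻_n` and `e + R ≤ pⁿ`. Then `g^{e}d, g^{e+1}d, …, g^{e+R−1}d` are linearly independent modulo `p·A`: a relation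
`∑ cᵢ g^{e+i}d = p·y`, `y ∈ A`, forces `p ∣ cᵢ` for all `i`. (With `a = (1+T)ⁱ` the functional `zᵢ` has `zᵢ(gʲd) = coeff_j(Q̃·Xⁱ)`,
`Q̃` monic of degree `e`: a unitriangular system.) [cite: Kobayashi2003, Prop. 8.23 (p. 22)] [cite: Sprung2012, Prop. 7.3]
[cite: Washington1997, Prop. 7.2] -/
theorem forall_dvd_of_onto (A : AddSubgroup (localPoints W E)) (g : Field.absoluteGaloisGroup E) (n : ℕ)
    (d : localPoints W E) (hA : ∀ j : ℕ, g ^ j • d ∈ A)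
    (honto : ∀ a : PowerSeries ℤ_[p], ∃ z : A →+ ℤ_[p],
      toIwasawa p (cyclotomicOmega p n) ∣ Sprung2012.pairingSum W A g n d z - toIwasawa p (cyclotomicOmegaMinus p n) * a)
    {R : ℕ} (hR : ((∏ k ∈ Icc 1 ((n + 1) / 2), cyclotomic (p ^ (2 * k - 1)) ℤ).map (Int.castRingHom ℤ_[p])).natDegree + R ≤ p ^ n)
    (c : Fin R → ℤ) {y : localPoints W E} (hy : y ∈ A)
    (hrel : ∑ i : Fin R,
      c i • g ^ (((∏ k ∈ Icc 1 ((n + 1) / 2), cyclotomic (p ^ (2 * k - 1)) ℤ).map (Int.castRingHom ℤ_[p])).natDegree + i) • d =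
        p • y) :
    ∀ i, (p : ℤ) ∣ c i := by
  set Q : ℤ_[p][X] := (∏ k ∈ Icc 1 ((n + 1) / 2), cyclotomic (p ^ (2 * k - 1)) ℤ).map (Int.castRingHom ℤ_[p]) with hQ
  have hQm : Q.Monic := monic_prod_cyclotomic_map n
  set e := Q.natDegree with he
  -- the functionals `z i` with `P(z i) ≡ ω⁻ (1+T)^i`
  choose z hz using fun i : Fin R ↦ honto ((1 + PowerSeries.X) ^ (i : ℕ))
  have hval : ∀ (i : Fin R) {j : ℕ}, j < p ^ n →
      Sprung2012.evalOn W A (z i) (g ^ j • d) = (Q * X ^ (i : ℕ)).coeff j := by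
    intro i j hj
    refine evalOn_pow_smul_eq_coeff_of_dvd W A g n d (z i) (Q * X ^ (i : ℕ)) ?_ ?_ hj
    · rw [natDegree_mul_X_pow (i : ℕ) hQm.ne_zero]; omega
    · rw [← toIwasawa_cyclotomicOmegaMinus_mul_pow_eq]; exact hz i
  have hx : ∀ i : Fin R, g ^ (e + i) • d ∈ A := fun i ↦ hA _
  refine forall_dvd_of_sum_zsmul_eq_nsmul_of_triangular (A := A) hx z ?_ ?_ c hy hrel
  · intro i
    rw [← Sprung2012.evalOn_of_mem W A (z i) (hx i), hval i (by omega), coeff_mul_X_pow', if_pos (by omega),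
      show e + i - i = e by omega]
    exact hQm.coeff_natDegree
  · intro i i' hii'
    rw [← Sprung2012.evalOn_of_mem W A (z i) (hx i'), hval i (by omega), coeff_mul_X_pow', if_pos (by omega)]
    exact coeff_eq_zero_of_natDegree_lt (by simp only [Fin.lt_def] at hii'; omega)

end Onto

/-! ## §4 `K = ℚ`, `p = 2`: rank growth of `E⁺(ℚ_{2,n})`, unconditionally for `GoodSS W 2`, `a₂ = 0` -/

section Two

open NumberField IsDedekindDomain

variable (W : WeierstrassCurve ℚ) [W.IsElliptic] [W.IsGloballyMinimal]

/-- `3·B ≤ 4^B`. [folklore] -/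
theorem three_mul_le_four_pow (B : ℕ) : 3 * B ≤ 4 ^ B := by
  induction B with
  | zero => simp
  | succ B ih => have := Nat.one_le_pow B 4 (by norm_num); rw [pow_succ]; omega

/-- **Rank growth of the plus points at `2`.** For `W/ℚ` globally minimal with good supersingular reduction at `2` and `a₂(W) = 0`,
the cyclotomic `ℤ₂`-extension `κ` and the place `v ∋ 2`: for every `B` there are a level `m` and `B` points
`x₀, …, x_{B−1} ∈ E⁺(ℚ_{2,2m})` (Kobayashi's plus points on the tower `ℚ_{2,n} = ℚ₂(ζ_{2^{n+2}})⁺`) which are linearly independent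
modulo `2·E(ℚ_{2,∞}·ℚ_v)`: `∑ cᵢ xᵢ = 2·y` with `y` in the tower forces all `cᵢ` even. (The points are `g^{e+i}•d_{2m}`, `i < B`,
for the HONDA⁺@2 family `d` and `e = deg ω⁻_{2m} = (4^m − 1)/3`; `m = B` suffices.) Equivalently `dim_{𝔽₂} E⁺(ℚ_{2,2m})/2 → ∞` —
the `p = 2` counterpart of «`rank E^±(k_n) → ∞`». [cite: Kobayashi2003, Thm. 6.2 and Prop. 8.23] [cite: BDKim2007, Prop. 3.17] -/
theorem exists_indep_mod_two_signedLocalPoints (hss : Rank1Residual.GoodSS W 2) (ha : W.frobeniusTrace 2 = 0)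
    (κ : ZpExtension ℚ 2) (hκ : κ.IsCyclotomic) (v : HeightOneSpectrum (𝓞 ℚ)) (hv : (2 : 𝓞 ℚ) ∈ v.asIdeal) (B : ℕ) :
    ∃ (m : ℕ) (x : Fin B → localPoints W (v.adicCompletion ℚ)),
      (∀ i, x i ∈ signedLocalPoints κ (v.adicCompletion ℚ) W 1 (2 * m)) ∧
      ∀ (c : Fin B → ℤ), ∀ y ∈ Sprung2012.localTowerPointsOfEmb κ (closureEmb (K := ℚ) (v.adicCompletion ℚ)) W,
        ∑ i, c i • x i = 2 • y → ∀ i, (2 : ℤ) ∣ c i := by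
  set ι := closureEmb (K := ℚ) (v.adicCompletion ℚ) with hι
  obtain ⟨g, d, hg, hL, hTR, -, honto⟩ := SignedColemanImage.hondaPlus_onto_two W hss ha κ hκ v hv
  set Q : ℤ_[2][X] := (∏ k ∈ Icc 1 ((2 * B + 1) / 2), cyclotomic (2 ^ (2 * k - 1)) ℤ).map (Int.castRingHom ℤ_[2]) with hQ
  set e := Q.natDegree with he
  have hdeg : (2 + 1) * e + 1 = 2 ^ (2 * B) := succ_mul_natDegree_add_one_eq_pow (p := 2) B
  have heB : e + B ≤ 2 ^ (2 * B) := by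
    have h4 : 2 ^ (2 * B) = 4 ^ B := by rw [pow_mul]; norm_num
    have := three_mul_le_four_pow B
    omega
  -- `Γ`-stability of the plus points and of the tower
  have hstab : ∀ (n : ℕ) (σ : Field.absoluteGaloisGroup (v.adicCompletion ℚ)),
      ∀ a ∈ signedLocalPointsOfEmb κ ι W 1 n, σ • a ∈ signedLocalPointsOfEmb κ ι W 1 n := by
    intro n σ a ha'
    rw [signedLocalPointsOfEmb_eq_towerSigned] at ha' ⊢
    exact smul_mem_towerSignedLocalPointsOfEmb κ.layerSubgroup ι W 1 n σ ha'
  have hd2B : d (2 * B) ∈ signedLocalPointsOfEmb κ ι W 1 (2 * B) :=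
    SignedEC.d_even_mem_signedLocalPointsOfEmb_one W κ ι d hL hTR B
  have hpow : ∀ j : ℕ, g ^ j • d (2 * B) ∈ signedLocalPointsOfEmb κ ι W 1 (2 * B) := by
    intro j
    induction j with
    | zero => simpa using hd2B
    | succ j ih => rw [pow_succ', mul_smul]; exact hstab _ g _ ih
  have hA : ∀ j : ℕ, g ^ j • d (2 * B) ∈ Sprung2012.localTowerPointsOfEmb κ ι W := fun j ↦
    Sprung2012.localLayerPointsOfEmb_le_localTowerPointsOfEmb κ ι W (2 * B)
      (((mem_signedLocalPointsOfEmb_iff κ ι W 1 (2 * B) _).1 (hpow j)).1)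
  refine ⟨B, fun i ↦ g ^ (e + i) • d (2 * B), fun i ↦ hpow _, fun c y hy hrel ↦ ?_⟩
  have h := forall_dvd_of_onto (p := 2) W (Sprung2012.localTowerPointsOfEmb κ ι W) g (2 * B) (d (2 * B)) hA (honto B)
    (R := B) heB c hy
  exact h (by exact_mod_cast hrel)

/-- **`⋃ₙ E⁺(ℚ_{2,n})` has infinitely many classes modulo `2`**: no finite set `F` represents every plus tower point modulo
`2·E(ℚ_{2,∞}·ℚ_v)` (the `2^B` combinations `∑ εᵢ xᵢ`, `εᵢ ∈ {0,1}`, of `B` independent points are pairwise incongruent; take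
`2^B > #F`). This is the hypothesis «`S[2]` infinite» of `…PlusDualFreeRankOne` for `S = (⋃ₙE⁺(ℚ_{2,n})) ⊗ ℚ₂/ℤ₂`, read on points.
[cite: BDKim2007, Prop. 3.17] [cite: Kobayashi2003, Thm. 6.2] -/
theorem not_exists_finset_cover_mod_two (hss : Rank1Residual.GoodSS W 2) (ha : W.frobeniusTrace 2 = 0)
    (κ : ZpExtension ℚ 2) (hκ : κ.IsCyclotomic) (v : HeightOneSpectrum (𝓞 ℚ)) (hv : (2 : 𝓞 ℚ) ∈ v.asIdeal) :
    ¬ ∃ F : Finset (localPoints W (v.adicCompletion ℚ)),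
      ∀ x ∈ (⨆ n, signedLocalPoints κ (v.adicCompletion ℚ) W 1 n), ∃ r ∈ F,
        ∃ y ∈ Sprung2012.localTowerPointsOfEmb κ (closureEmb (K := ℚ) (v.adicCompletion ℚ)) W, x = r + 2 • y := by
  rintro ⟨F, hF⟩
  set ι := closureEmb (K := ℚ) (v.adicCompletion ℚ) with hι
  -- `B` with `#F < 2^B`, and `B` independent plus points
  set B := F.card + 1 with hB
  have hFB : F.card < 2 ^ B := lt_of_lt_of_le (Nat.lt_succ_self _) (by rw [hB]; exact Nat.lt_two_pow_self.le)
  obtain ⟨m, x, hx, hind⟩ := exists_indep_mod_two_signedLocalPoints W hss ha κ hκ v hv B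
  -- the `2^B` combinations
  let comb : (Fin B → Fin 2) → localPoints W (v.adicCompletion ℚ) := fun ε ↦ ∑ i, ((ε i : ℕ) : ℤ) • x i
  have hcombA : ∀ ε, comb ε ∈ (⨆ n, signedLocalPoints κ (v.adicCompletion ℚ) W 1 n) := by
    intro ε
    refine AddSubgroup.sum_mem _ fun i _ ↦ AddSubgroup.zsmul_mem _ ?_ _
    exact (le_iSup (fun n ↦ signedLocalPoints κ (v.adicCompletion ℚ) W 1 n) (2 * m)) (hx i)
  choose r hrF y hyA hry using fun ε ↦ hF (comb ε) (hcombA ε)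
  -- `ε ↦ r ε` is injective: equal representatives give a relation `∑ (ε − ε') x = 2·(y' − y)`
  have hinj : Function.Injective r := by
    intro ε ε' hεε'
    have hrel : ∑ i, (((ε i : ℕ) : ℤ) - ((ε' i : ℕ) : ℤ)) • x i = 2 • (y ε - y ε') := by
      have e1 : comb ε - comb ε' = 2 • (y ε - y ε') := by rw [hry ε, hry ε', hεε', smul_sub]; abel
      rw [← e1]
      simp only [comb, sub_smul, Finset.sum_sub_distrib]
    have hdvd := hind (fun i ↦ ((ε i : ℕ) : ℤ) - ((ε' i : ℕ) : ℤ)) (y ε - y ε')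
      (AddSubgroup.sub_mem _ (hyA ε) (hyA ε')) hrel
    funext i
    have hi := hdvd i
    have h1 : ((ε i : ℕ) : ℤ) < 2 := by exact_mod_cast (ε i).2
    have h2 : ((ε' i : ℕ) : ℤ) < 2 := by exact_mod_cast (ε' i).2
    have h3 : (0 : ℤ) ≤ ((ε i : ℕ) : ℤ) := by positivity
    have h4 : (0 : ℤ) ≤ ((ε' i : ℕ) : ℤ) := by positivity
    have : ((ε i : ℕ) : ℤ) = ((ε' i : ℕ) : ℤ) := by omega
    exact Fin.ext (by exact_mod_cast this)
  have hsub : Finset.univ.image r ⊆ F := by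
    intro t ht
    obtain ⟨ε, -, rfl⟩ := Finset.mem_image.mp ht
    exact hrF ε
  have hcard := Finset.card_le_card hsub
  rw [Finset.card_image_of_injective _ hinj, Finset.card_univ, Fintype.card_fun, Fintype.card_fin,
    Fintype.card_fin] at hcard
  omega

end Two

end Summit.BirchSwinnertonDyer.BirchSwinnertonDyer.Theorems.SignedEC.PlusRankGrowth

end
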